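import Literature.Analysis.OperatorTheory.HermitianKernelOperator
import Literature.Analysis.OperatorTheory.ComplexKernelCyclicPeeling
import HarnessLib

/-!
# Graded spectral trace formula for the cyclic integrals of a bounded Hermitian kernel (`RCLike` scalars)

Topic `Literature/Analysis/OperatorTheory`; the complex (`RCLike 𝕜`) port of the REAL chain
`KernelIterateBridge.lean` → `PositiveKernelSpectralTrace.lean` (`hasSum_pow_integral_iterate_diag`) →
`PositiveKernelSpectralTraceTwo.lean` (`hasSum_pow_integral_cyclic`), now for a HERMITIAN bounded kernel
`K(x, y) = conj K(y, x)` on a finite measure space, REAL eigenvalues of either sign (no positivity: dominated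
instead of monotone convergence) and ONE bounded multiplication insertion `θ`.  Setting: `A` is any bounded operator
on `L²(X, μ; 𝕜)` with `A φ =ᵐ ∫ K(·, y) φ(y) dμ(y)` (`HermitianKernelOperator.lean`: it is compact self-adjoint),
`(bᵢ)` a countable Hilbert basis with `A bᵢ = λᵢ bᵢ`, `λᵢ ∈ ℝ` (`CompactSelfAdjointEigenbasis.lean`), and
`κ f = ∫ K(·, z) f(z) dμ(z)` the pointwise operator (written out; no definitions).  With Mathlib's convention
(inner product conjugate-linear in the FIRST slot, `⟪f, g⟫ = ∫ conj f · g`) the `L²` section of the kernel at `x` is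
`k_x = conj K(x, ·)`, so that `⟪k_x, φ⟫ = ∫ K(x, y) φ(y) = (κ φ)(x)` (`integral_kernel_mul_eq_inner`), and Hermitian
symmetry reads `K(·, x) = k_x`.

* `pow_apply_basis_rclike`, `norm_eigval_le_opNorm`, `integral_kernel_mul_basis_ae_eq` — bookkeeping:
  `A^j bᵢ = λᵢ^j bᵢ`, `|λᵢ| ≤ ‖A‖`, `κ bᵢ =ᵐ λᵢ bᵢ`;
* `pow_kernelOp_toLp_ae_eq_iterate_rclike`, `inner_conj_section_pow_kernelOp` — `A^j [h] =ᵐ κ^[j] h` and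
  `⟪k_u, A^j [h]⟫ = (κ^[j+1] h)(u)` for EVERY `u`, for bounded measurable `h` (no symmetry needed);
* `iterate_kernel_eq_inner_rclike` — the iterated kernel `(κ^[j+1] K(·, x))(y) = ⟪k_y, A^j k_x⟫` (Hermitian);
* `hasSum_inner_conj_section_pow` — Parseval: `⟪k_y, A^j k_x⟫ = Σᵢ λᵢ^j (κ bᵢ)(y) conj((κ bᵢ)(x))`;
* `hasSum_pow_integral_obs_iterate_diag_rclike` — **graded trace of powers**:
  `Σᵢ λᵢ^{M+2} ∫ conj bᵢ · θ · bᵢ dμ = ∫ θ(x) (κ^[M+1] K(·, x))(x) dμ(x)` ("`Tr(Θ A^{M+2})`" without a trace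
  class; sum/integral interchanged by dominated convergence with the Bessel–Parseval dominant
  `Σᵢ |(κ bᵢ)(x)|² = ∫ |K(x, ·)|² ≤ C² μ(X)`, `hasSum_norm_sq_integral_kernel_mul`);
* `hasSum_pow_integral_cyclic_obs_rclike` and its `𝕜 = ℂ` instance `hasSum_pow_integral_cyclic_obs` — the
  **periodic path-integral form**: `Σᵢ λᵢ^{M+2} ⟪bᵢ, θ bᵢ⟫ = ∫ θ(V 0) ∏_{t : Fin (M+2)} K(V t, V (t+1)) dμ^{⊗(M+2)}(V)`
  (with `ComplexKernelCyclicPeeling.integral_cyclic_obs_eq_integral_iterate_rclike`).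
References: B. Simon, *Trace Ideals and Their Applications* (2005), Ch. 3 (Thm. 3.1: trace of a product of
Hilbert–Schmidt operators as an integral of kernels); M. Reed, B. Simon, *Methods of Modern Mathematical Physics I*
(1980), §VI.6, Thm. VI.22–VI.23. Mathlib + `HermitianKernelOperator.lean` / `IntegralOperatorHilbertSchmidt.lean` /
`ComplexKernelCyclicPeeling.lean` only; no definitions. [folklore]
-/

noncomputable section

open MeasureTheory Filter Set Function
open scoped InnerProductSpace ComplexConjugate ENNReal

namespace Literature.Analysis.OperatorTheory

variable {𝕜 : Type*} [RCLike 𝕜] {X : Type*} [MeasurableSpace X] {μ : Measure X} [IsFiniteMeasure μ]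
  {K : X → X → 𝕜} {C : ℝ} {A : Lp 𝕜 2 μ →L[𝕜] Lp 𝕜 2 μ} {ι : Type*}
  {b : HilbertBasis ι 𝕜 (Lp 𝕜 2 μ)} {lam : ι → ℝ}

/-! ### Eigenbasis bookkeeping -/

omit [IsFiniteMeasure μ] in
/-- Powers act diagonally on an eigenbasis: `A^j bᵢ = cᵢ^j bᵢ` (`RCLike` scalars). [folklore] -/
theorem pow_apply_basis_rclike {c : ι → 𝕜} (hb : ∀ i, A (b i) = c i • b i) (j : ℕ) (i : ι) :
    (A ^ j) (b i) = c i ^ j • b i := by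
  induction j with
  | zero => simp
  | succ j ih =>
    rw [pow_succ', mul_apply_eq_comp, ih, map_smul, hb, smul_smul, pow_succ, mul_comm]

omit [IsFiniteMeasure μ] in
/-- `‖cᵢ‖ ≤ ‖A‖` for an eigenvalue `cᵢ` of a normalised eigenvector. [folklore] -/
theorem norm_eigval_le_opNorm {c : ι → 𝕜} (hb : ∀ i, A (b i) = c i • b i) (i : ι) : ‖c i‖ ≤ ‖A‖ := by
  have h1 : ‖A (b i)‖ = ‖c i‖ := by
    rw [hb, norm_smul, b.orthonormal.norm_eq_one i, mul_one]
  rw [← h1]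
  calc ‖A (b i)‖ ≤ ‖A‖ * ‖b i‖ := A.le_opNorm _
    _ = ‖A‖ := by rw [b.orthonormal.norm_eq_one i, mul_one]

omit [IsFiniteMeasure μ] in
/-- **`κ bᵢ = λᵢ bᵢ` almost everywhere**: the honest function `x ↦ ∫ K(x, z) bᵢ(z) dμ(z)` agrees a.e. with
`cᵢ bᵢ` (the kernel formula for `A bᵢ` and `Lp.coeFn_smul`). [folklore] -/
theorem integral_kernel_mul_basis_ae_eq {c : ι → 𝕜}
    (hA : ∀ φ : Lp 𝕜 2 μ, (A φ : X → 𝕜) =ᵐ[μ] fun x => ∫ y, K x y * φ y ∂μ)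
    (hb : ∀ i, A (b i) = c i • b i) (i : ι) :
    (fun x => ∫ z, K x z * b i z ∂μ) =ᵐ[μ] fun x => c i * b i x := by
  have h2 : ((A (b i) : Lp 𝕜 2 μ) : X → 𝕜) =ᵐ[μ] fun x => c i * b i x := by
    rw [hb]
    filter_upwards [Lp.coeFn_smul (c i) (b i : Lp 𝕜 2 μ)] with x hx
    rw [hx, Pi.smul_apply, smul_eq_mul]
  exact (hA (b i)).symm.trans h2

/-! ### Powers of `A` versus iterates of the pointwise operator -/

/-- For a bounded measurable `h`, the class `[h] ∈ L²` of a finite measure (`RCLike`-valued). [folklore] -/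
theorem memLp_two_of_bound_rclike {h : X → 𝕜} (hh : Measurable h) {B : ℝ} (hhb : ∀ x, ‖h x‖ ≤ B) :
    MemLp h 2 μ :=
  MemLp.of_bound hh.aestronglyMeasurable B (Eventually.of_forall hhb)

/-- **`A^j [h] = κ^[j] h` almost everywhere** (`RCLike` port of `pow_kernelOp_toLp_ae_eq_iterate`): the powers of
the `L²` operator act on the class of a bounded measurable `h` as the iterates of the pointwise kernel operator.
[folklore] -/
theorem pow_kernelOp_toLp_ae_eq_iterate_rclike
    (hA : ∀ φ : Lp 𝕜 2 μ, (A φ : X → 𝕜) =ᵐ[μ] fun x => ∫ y, K x y * φ y ∂μ)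
    {h : X → 𝕜} (hh : Measurable h) {B : ℝ} (hhb : ∀ x, ‖h x‖ ≤ B) (j : ℕ) :
    ((A ^ j) ((memLp_two_of_bound_rclike (μ := μ) hh hhb).toLp h) : X → 𝕜) =ᵐ[μ]
      (fun f : X → 𝕜 => fun x => ∫ y, K x y * f y ∂μ)^[j] h := by
  induction j with
  | zero =>
    simp only [pow_zero, one_apply_eq_self, Function.iterate_zero, id_eq]
    exact (memLp_two_of_bound_rclike hh hhb).coeFn_toLp
  | succ j ih =>
    rw [pow_succ', mul_apply_eq_comp, Function.iterate_succ_apply']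
    filter_upwards [hA ((A ^ j) ((memLp_two_of_bound_rclike (μ := μ) hh hhb).toLp h))] with x hx
    rw [hx]
    exact integral_congr_ae (by filter_upwards [ih] with y hy; rw [hy])

/-- **`⟪k_u, A^j [h]⟫ = (κ^[j+1] h)(u)` for every `u`**, with `k_u = conj K(u, ·)` the `L²` kernel section: pairing
with the section performs one more, honest, kernel integration (no symmetry of `K` is needed with this section).
[folklore] -/
theorem inner_conj_section_pow_kernelOp (hK : StronglyMeasurable (uncurry K)) (hC : ∀ x y, ‖K x y‖ ≤ C)
    (hA : ∀ φ : Lp 𝕜 2 μ, (A φ : X → 𝕜) =ᵐ[μ] fun x => ∫ y, K x y * φ y ∂μ)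
    {h : X → 𝕜} (hh : Measurable h) {B : ℝ} (hhb : ∀ x, ‖h x‖ ≤ B) (j : ℕ) (u : X) :
    ⟪(memLp_two_conj_kernel_section (μ := μ) hK hC u).toLp (fun y => conj (K u y)),
        (A ^ j) ((memLp_two_of_bound_rclike (μ := μ) hh hhb).toLp h)⟫_𝕜 =
      ((fun f : X → 𝕜 => fun x => ∫ y, K x y * f y ∂μ)^[j + 1] h) u := by
  rw [← integral_kernel_mul_eq_inner hK hC u, Function.iterate_succ_apply']
  refine integral_congr_ae ?_
  filter_upwards [pow_kernelOp_toLp_ae_eq_iterate_rclike hA hh hhb j] with y hy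
  rw [hy]

/-- Measurability of the conjugate kernel section `y ↦ conj K(x, y)`. [folklore] -/
theorem measurable_conj_kernel_section (hK : StronglyMeasurable (uncurry K)) (x : X) :
    Measurable fun y => conj (K x y) :=
  RCLike.continuous_conj.measurable.comp hK.measurable.of_uncurry_left

omit [MeasurableSpace X] in
/-- The conjugate kernel section is bounded by the kernel bound. [folklore] -/
theorem norm_conj_kernel_section_le (hC : ∀ x y, ‖K x y‖ ≤ C) (x y : X) : ‖conj (K x y)‖ ≤ C := by
  rw [RCLike.norm_conj]; exact hC x y

/-- **The iterated kernel is an inner product of sections** (Hermitian kernel):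
`(κ^[j+1] K(·, x))(y) = ⟪k_y, A^j k_x⟫` with `k_x = conj K(x, ·) = K(·, x)`. [folklore] -/
theorem iterate_kernel_eq_inner_rclike (hK : StronglyMeasurable (uncurry K)) (hC : ∀ x y, ‖K x y‖ ≤ C)
    (hherm : ∀ x y, K x y = conj (K y x))
    (hA : ∀ φ : Lp 𝕜 2 μ, (A φ : X → 𝕜) =ᵐ[μ] fun x => ∫ y, K x y * φ y ∂μ) (j : ℕ) (x y : X) :
    ((fun f : X → 𝕜 => fun w => ∫ z, K w z * f z ∂μ)^[j + 1] (fun z => K z x)) y =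
      ⟪(memLp_two_conj_kernel_section (μ := μ) hK hC y).toLp (fun z => conj (K y z)),
        (A ^ j) ((memLp_two_conj_kernel_section (μ := μ) hK hC x).toLp (fun z => conj (K x z)))⟫_𝕜 := by
  have hKx : (fun z => K z x) = fun z => conj (K x z) := funext fun z => hherm z x
  rw [hKx]
  exact (inner_conj_section_pow_kernelOp hK hC hA (measurable_conj_kernel_section hK x)
    (norm_conj_kernel_section_le hC x) j y).symm

/-! ### The pointwise spectral expansion of the iterated kernel -/

/-- **`⟪k_y, A^j k_x⟫ = Σᵢ λᵢ^j (κ bᵢ)(y) conj((κ bᵢ)(x))` for every `x, y`** (Parseval in the eigenbasis,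
self-adjointness of `A^j`, real eigenvalues; `(κ bᵢ)(x) = ∫ K(x, z) bᵢ(z) dμ(z) = ⟪k_x, bᵢ⟫`).  With
`iterate_kernel_eq_inner_rclike` the left-hand side is the iterated kernel `K^{(j+2)}(y, x)`. [folklore] -/
theorem hasSum_inner_conj_section_pow (hK : StronglyMeasurable (uncurry K)) (hC : ∀ x y, ‖K x y‖ ≤ C)
    (hherm : ∀ x y, K x y = conj (K y x))
    (hA : ∀ φ : Lp 𝕜 2 μ, (A φ : X → 𝕜) =ᵐ[μ] fun x => ∫ y, K x y * φ y ∂μ)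
    (hb : ∀ i, A (b i) = (lam i : 𝕜) • b i) (j : ℕ) (x y : X) :
    HasSum (fun i => (lam i : 𝕜) ^ j * ((∫ z, K y z * b i z ∂μ) * conj (∫ z, K x z * b i z ∂μ)))
      ⟪(memLp_two_conj_kernel_section (μ := μ) hK hC y).toLp (fun z => conj (K y z)),
        (A ^ j) ((memLp_two_conj_kernel_section (μ := μ) hK hC x).toLp (fun z => conj (K x z)))⟫_𝕜 := by
  set kx : Lp 𝕜 2 μ := (memLp_two_conj_kernel_section (μ := μ) hK hC x).toLp (fun z => conj (K x z))
  set ky : Lp 𝕜 2 μ := (memLp_two_conj_kernel_section (μ := μ) hK hC y).toLp (fun z => conj (K y z))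
  have hsa : IsSelfAdjoint (A ^ j) := (isSelfAdjoint_of_ae_hermitianKernel hK hC hherm hA).pow j
  have h := b.hasSum_inner_mul_inner ky ((A ^ j) kx)
  refine h.congr_fun fun i => ?_
  have h2 : ⟪b i, (A ^ j) kx⟫_𝕜 = (lam i : 𝕜) ^ j * ⟪b i, kx⟫_𝕜 := by
    rw [← hsa.adjoint_eq, ContinuousLinearMap.adjoint_inner_right, pow_apply_basis_rclike hb j i,
      inner_smul_left, ← RCLike.ofReal_pow, RCLike.conj_ofReal, RCLike.ofReal_pow]
  rw [h2, ← inner_conj_symm (b i) kx, ← integral_kernel_mul_eq_inner hK hC x (b i),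
    ← integral_kernel_mul_eq_inner hK hC y (b i)]
  ring

/-- **Bessel–Parseval bound for the section coefficients**: `Σᵢ |(κ bᵢ)(x)|² = ∫ |K(x, ·)|² ≤ C² μ(X)`.
[folklore] -/
theorem tsum_norm_sq_integral_kernel_mul_le (hK : StronglyMeasurable (uncurry K)) (hC : ∀ x y, ‖K x y‖ ≤ C)
    (b : HilbertBasis ι 𝕜 (Lp 𝕜 2 μ)) (x : X) :
    Summable (fun i => ‖∫ z, K x z * b i z ∂μ‖ ^ 2) ∧
      ∑' i, ‖∫ z, K x z * b i z ∂μ‖ ^ 2 = ∫ z, ‖K x z‖ ^ 2 ∂μ ∧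
        ∫ z, ‖K x z‖ ^ 2 ∂μ ≤ C ^ 2 * μ.real univ := by
  have h := hasSum_norm_sq_integral_kernel_mul (𝕜 := 𝕜) hK hC b x
  refine ⟨h.summable, h.tsum_eq, ?_⟩
  calc ∫ z, ‖K x z‖ ^ 2 ∂μ ≤ ∫ _z, C ^ 2 ∂μ :=
        integral_mono_of_nonneg (Eventually.of_forall fun z => by positivity) (integrable_const _)
          (Eventually.of_forall fun z => pow_le_pow_left₀ (norm_nonneg _) (hC x z) 2)
    _ = C ^ 2 * μ.real univ := by rw [integral_const, smul_eq_mul, mul_comm]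

/-! ### Graded trace of powers -/

/-- **Graded trace of powers (diagonal form).**  For a bounded Hermitian kernel with `L²` operator `A`, a Hilbert
basis of eigenvectors `A bᵢ = λᵢ bᵢ` with real eigenvalues, and a bounded measurable insertion `θ`:
`Σᵢ λᵢ^{M+2} ∫ conj bᵢ(x) θ(x) bᵢ(x) dμ(x) = ∫ θ(x) (κ^[M+1] K(·, x))(x) dμ(x)` — i.e. `Tr(Θ A^{M+2})`, `Θ` the
multiplication by `θ`, equals the diagonal integral of the `(M+2)`-fold iterated kernel against `θ`, without a trace
class (pointwise expansion `hasSum_inner_conj_section_pow` on the diagonal, `κ bᵢ =ᵐ λᵢ bᵢ`, and dominated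
convergence with dominant `‖θ‖_∞ ‖A‖^M Σᵢ |(κ bᵢ)(x)|² ≤ ‖θ‖_∞ ‖A‖^M C² μ(X)`). [folklore] -/
theorem hasSum_pow_integral_obs_iterate_diag_rclike [Countable ι] (hK : StronglyMeasurable (uncurry K))
    (hC : ∀ x y, ‖K x y‖ ≤ C) (hherm : ∀ x y, K x y = conj (K y x))
    (hA : ∀ φ : Lp 𝕜 2 μ, (A φ : X → 𝕜) =ᵐ[μ] fun x => ∫ y, K x y * φ y ∂μ)
    (hb : ∀ i, A (b i) = (lam i : 𝕜) • b i) {θ : X → 𝕜} (hθ : Measurable θ) {Cθ : ℝ}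
    (hθb : ∀ x, ‖θ x‖ ≤ Cθ) (M : ℕ) :
    HasSum (fun i => (lam i : 𝕜) ^ (M + 2) * ∫ x, conj (b i x) * (θ x * b i x) ∂μ)
      (∫ x, θ x * ((fun f : X → 𝕜 => fun w => ∫ z, K w z * f z ∂μ)^[M + 1] (fun z => K z x)) x ∂μ) := by
  -- notation: `cf i x = (κ bᵢ)(x)`, the terms `F i x = θ(x) λᵢ^M |cf i x|²`, the dominant `bd i x`
  set cf : ι → X → 𝕜 := fun i x => ∫ z, K x z * b i z ∂μ with hcf
  set F : ι → X → 𝕜 := fun i x => θ x * ((lam i : 𝕜) ^ M * (cf i x * conj (cf i x))) with hF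
  set bd : ι → X → ℝ := fun i x => Cθ * ‖A‖ ^ M * ‖cf i x‖ ^ 2 with hbd
  have hcfm : ∀ i, Measurable (cf i) := fun i => (stronglyMeasurable_integral_kernel_mul hK (b i)).measurable
  have hFm : ∀ i, Measurable (F i) := fun i =>
    hθ.mul ((((hcfm i).mul (RCLike.continuous_conj.measurable.comp (hcfm i)))).const_mul _)
  have hlamA : ∀ i, ‖(lam i : 𝕜)‖ ≤ ‖A‖ := norm_eigval_le_opNorm hb
  -- (0) pointwise expansion of the integrand on the diagonal
  have hpt : ∀ x, HasSum (fun i => F i x)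
      (θ x * ((fun f : X → 𝕜 => fun w => ∫ z, K w z * f z ∂μ)^[M + 1] (fun z => K z x)) x) := fun x => by
    rw [iterate_kernel_eq_inner_rclike hK hC hherm hA M x x]
    exact (hasSum_inner_conj_section_pow hK hC hherm hA hb M x x).mul_left (θ x)
  -- (1) domination
  have hbound : ∀ i x, ‖F i x‖ ≤ bd i x := fun i x => by
    simp only [hF, hbd]
    rw [norm_mul, norm_mul, norm_mul, norm_pow, RCLike.norm_conj, ← sq]
    have hCθ0 : 0 ≤ Cθ := (norm_nonneg _).trans (hθb x)
    have h2 : ‖(lam i : 𝕜)‖ ^ M ≤ ‖A‖ ^ M := pow_le_pow_left₀ (norm_nonneg _) (hlamA i) M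
    calc ‖θ x‖ * (‖(lam i : 𝕜)‖ ^ M * ‖cf i x‖ ^ 2) ≤ Cθ * (‖A‖ ^ M * ‖cf i x‖ ^ 2) := by
          gcongr
          exact hθb x
      _ = Cθ * ‖A‖ ^ M * ‖cf i x‖ ^ 2 := by ring
  have hpars : ∀ x, Summable (fun i => ‖cf i x‖ ^ 2) ∧ ∑' i, ‖cf i x‖ ^ 2 = ∫ z, ‖K x z‖ ^ 2 ∂μ ∧
      ∫ z, ‖K x z‖ ^ 2 ∂μ ≤ C ^ 2 * μ.real univ := fun x => tsum_norm_sq_integral_kernel_mul_le hK hC b x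
  have hbd_sum : ∀ x, Summable fun i => bd i x := fun x => (hpars x).1.mul_left _
  have hsq_meas : Measurable fun x => ∫ z, ‖K x z‖ ^ 2 ∂μ :=
    (stronglyMeasurable_integral_norm_kernel_sq hK).measurable
  have hbd_int : Integrable (fun x => ∑' i, bd i x) μ := by
    have hfun : (fun x => ∑' i, bd i x) = fun x => Cθ * ‖A‖ ^ M * ∫ z, ‖K x z‖ ^ 2 ∂μ := by
      funext x
      simp only [hbd]
      rw [tsum_mul_left, (hpars x).2.1]
    rw [hfun]
    exact (Integrable.of_bound hsq_meas.aestronglyMeasurable (C ^ 2 * μ.real univ)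
      (Eventually.of_forall fun x => by
        rw [Real.norm_eq_abs, abs_of_nonneg (integral_nonneg fun z => by positivity)]
        exact (hpars x).2.2)).const_mul _
  have key := hasSum_integral_of_dominated_convergence (μ := μ) bd
    (fun i => (hFm i).aestronglyMeasurable) (fun i => Eventually.of_forall (hbound i))
    (Eventually.of_forall hbd_sum) hbd_int (Eventually.of_forall hpt)
  -- (2) the terms: `∫ θ λᵢ^M |κ bᵢ|² = λᵢ^{M+2} ∫ conj bᵢ θ bᵢ`
  refine key.congr_fun fun i => ?_
  rw [← integral_const_mul]
  refine integral_congr_ae ?_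
  filter_upwards [integral_kernel_mul_basis_ae_eq hA hb i] with x hx
  simp only [hF, hcf] at hx ⊢
  rw [hx, map_mul, RCLike.conj_ofReal]
  ring

/-! ### Graded trace of powers in cyclic (periodic path-integral) form -/

/-- **`Tr(Θ A^{M+2})` as a periodic path integral** (`RCLike` scalars).  For a bounded Hermitian kernel `K` on a
finite measure space with `L²` operator `A`, a countable Hilbert basis of eigenvectors `A bᵢ = λᵢ bᵢ` (real `λᵢ`)
and a bounded measurable insertion `θ`:
`Σᵢ λᵢ^{M+2} ∫ conj bᵢ · θ · bᵢ dμ = ∫ θ(V 0) ∏_{t : Fin (M+2)} K(V t, V (t+1)) dμ^{⊗(M+2)}(V)` — the cyclic integral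
of `M + 2` copies of the kernel with `θ` inserted at site `0` (`integral_cyclic_obs_eq_integral_iterate_rclike`
combined with `hasSum_pow_integral_obs_iterate_diag_rclike`). [folklore] -/
theorem hasSum_pow_integral_cyclic_obs_rclike [Countable ι] (hK : StronglyMeasurable (uncurry K))
    (hC : ∀ x y, ‖K x y‖ ≤ C) (hherm : ∀ x y, K x y = conj (K y x))
    (hA : ∀ φ : Lp 𝕜 2 μ, (A φ : X → 𝕜) =ᵐ[μ] fun x => ∫ y, K x y * φ y ∂μ)
    (hb : ∀ i, A (b i) = (lam i : 𝕜) • b i) {θ : X → 𝕜} (hθ : Measurable θ) {Cθ : ℝ}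
    (hθb : ∀ x, ‖θ x‖ ≤ Cθ) (M : ℕ) :
    HasSum (fun i => (lam i : 𝕜) ^ (M + 2) * ∫ x, conj (b i x) * (θ x * b i x) ∂μ)
      (∫ V : Fin (M + 2) → X, θ (V 0) * ∏ t, K (V t) (V (t + 1)) ∂(Measure.pi fun _ => μ)) := by
  rw [integral_cyclic_obs_eq_integral_iterate_rclike (ρ := μ) hK.measurable hC M hθ hθb]
  exact hasSum_pow_integral_obs_iterate_diag_rclike hK hC hherm hA hb hθ hθb M

/-- **Graded trace of powers of a bounded Hermitian complex kernel as a periodic path integral.**  For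
`K : X → X → ℂ` strongly measurable, bounded and Hermitian on a finite measure space, ANY bounded operator `A` on
`L²(X, μ; ℂ)` with `(Aφ)(x) = ∫ K(x, y) φ(y) dμ(y)` a.e. (it is compact self-adjoint, `exists_hermitianKernelOp`), any
countable Hilbert basis `(bᵢ)` of eigenvectors with real eigenvalues `λᵢ`, and any bounded measurable `θ : X → ℂ`:
`Σᵢ λᵢ^{M+2} ∫ conj bᵢ(x) θ(x) bᵢ(x) dμ(x) = ∫ θ(V 0) ∏_{t : Fin (M+2)} K(V t, V (t+1)) dμ^{⊗(M+2)}(V)`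
("`Tr(Θ A^{M+2})`", `Θ` = multiplication by `θ`, e.g. a fermion-parity grading, without trace-class theory;
`hasSum_pow_integral_cyclic_obs_rclike` at `𝕜 = ℂ`; `conj = starRingEnd ℂ`; B. Simon, *Trace Ideals* (2005), Ch. 3).
[folklore] -/
theorem hasSum_pow_integral_cyclic_obs : ∀ {X : Type*} [MeasurableSpace X] (μ : Measure X)
    [IsFiniteMeasure μ] (K : X → X → ℂ) (C : ℝ), StronglyMeasurable (uncurry K) → (∀ x y, ‖K x y‖ ≤ C) →
    (∀ x y, K x y = conj (K y x)) →
    ∀ (A : Lp ℂ 2 μ →L[ℂ] Lp ℂ 2 μ),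
      (∀ φ : Lp ℂ 2 μ, (A φ : X → ℂ) =ᵐ[μ] fun x => ∫ y, K x y * φ y ∂μ) →
      ∀ {ι : Type*} [Countable ι] (b : HilbertBasis ι ℂ (Lp ℂ 2 μ)) (lam : ι → ℝ),
        (∀ i, A (b i) = (lam i : ℂ) • (b i : Lp ℂ 2 μ)) →
        ∀ (θ : X → ℂ) (Cθ : ℝ), Measurable θ → (∀ x, ‖θ x‖ ≤ Cθ) →
          ∀ M : ℕ, HasSum (fun i => (lam i : ℂ) ^ (M + 2) *
              ∫ x, conj ((b i : Lp ℂ 2 μ) x) * (θ x * (b i : Lp ℂ 2 μ) x) ∂μ)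
            (∫ V : Fin (M + 2) → X, θ (V 0) * ∏ t, K (V t) (V (t + 1)) ∂(Measure.pi fun _ => μ)) := by
  intro X _ μ _ K C hK hC hherm A hA ι _ b lam hb θ Cθ hθ hθb M
  exact hasSum_pow_integral_cyclic_obs_rclike hK hC hherm hA hb hθ hθb M

end Literature.Analysis.OperatorTheory

end
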